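import Mathlib.Data.Prod.Lex
import Mathlib.Data.Fin.Tuple.Sort
import Mathlib.Analysis.SpecialFunctions.Log.Base
import Literature.Computability.AlgebraicComplexity.WeightedEntropyMax
import Literature.Computability.AlgebraicComplexity.SupportFlags
import HarnessLib

/-!
# The upper support functional of oblique tensors and of matrix multiplication (Strassen; CVZ Thm. 2.19)

Topic: `Literature/Computability/AlgebraicComplexity`. Strassen's computation of the upper support
functional `ζ^θ` (`upperSupportFunctional`, `QuantumFunctionals.lean`, CVZ Def. 2.3) on tensors whose
support in the standard bases is an antichain for a product of total orders (*oblique* tensors, CVZ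
Def. 2.18), and its value on the matrix multiplication tensors `⟨a, b, c⟩` (`matMulTensor`), whose
support is tight and hence an antichain:

* `weightedEntropy_le_logUpperSupportFunctional_of_antichain`,
  `logUpperSupportFunctional_eq_maxWeightedEntropy_of_antichain` — **CVZ Thm. 2.19 (Strassen)** for
  a tensor oblique in the standard bases: `ρ^θ(t) = H_θ(supp t)`, i.e. no change of bases decreases the
  maximal `θ`-weighted marginal entropy of the support. Proof ([Str91, §4]; the route of [CVZ23, §2.3]):
  for bases `C = (A, B, C)` let `P*` maximise `H_θ` on `P(supp_C t)` (`WeightedEntropyMax.lean`) and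
  order the new index sets so that the marginals of `P*` increase (`exists_rank_monotone`); by the
  permutation lemma (`SupportFlags.lean`, CVZ Prop. 2.16) every `x ∈ supp t` is dominated after
  injections `φᵢ` by a point of `supp_C t`, where the first-order conditions bound the score by
  `H_θ(P*)`; Gibbs' inequality with the dual variables `P*ᵢ ∘ φᵢ` then gives `H_θ(P) ≤ H_θ(P*)` for every
  `P ∈ P(supp t)`.
* `logUpperSupportFunctional_matMulTensor`, `upperSupportFunctional_matMulTensor` — **Strassen
  ([Str91]); CLLZ Lemma 4.1:** for `a, b, c ≥ 1` and `θ ∈ P([3])`,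
  `ζ^θ(⟨a,b,c⟩) = (ac)^{θ 0} (ab)^{θ 1} (bc)^{θ 2} = a^{θ 0+θ 1} b^{θ 1+θ 2} c^{θ 0+θ 2}` in the tree's index
  convention (`matMulTensor K a b c : (Fin a × Fin c) → (Fin a × Fin b) → (Fin b × Fin c) → K`), over
  every field: the upper bound is the dimension bound, the lower bound is the oblique theorem applied
  to the uniform distribution on the support (uniform marginals). The antichain orders are
  lexicographic: `(k, i)`, `(j, -i)`, `(-j, -k)` on the three index sets.

References: V. Strassen, *Degeneration and complexity of bilinear maps: some asymptotic spectra*,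
J. reine angew. Math. 413 (1991), 127–180 (`Strassen1991`); M. Christandl, P. Vrana, J. Zuiddam,
*Universal points in the asymptotic spectrum of tensors*, J. Amer. Math. Soc. 36 (2023), Thm. 2.19
(`ChristandlVranaZuiddam2023`); M. Christandl, F. Le Gall, V. Lysikov, J. Zuiddam, *Barriers for
rectangular matrix multiplication*, comput. complexity 34 (2025), Lemma 4.1
(`ChristandlLeGallLysikovZuiddam2025`; the printed proof is "One verifies this by a direct
computation. See also [Str91]."); P. Bürgisser, M. Clausen, M. A. Shokrollahi, *Algebraic Complexity
Theory* (1997), Rem. 15.35(3) (`BurgisserClausenShokrollahi1997`).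
-/

noncomputable section

open scoped BigOperators
open Real (negMulLog)

namespace Literature.Computability.AlgebraicComplexity

/-! ## Ranks adapted to a real function -/

/-- Sorting: every real function on a finite type is monotone along some injective rank function
(`Tuple.sort`). [folklore] -/
theorem exists_rank_monotone {ι : Type*} [Fintype ι] (f : ι → ℝ) :
    ∃ r : ι → ℕ, Function.Injective r ∧ ∀ a b, r a ≤ r b → f a ≤ f b := by
  classical
  set e : ι ≃ Fin (Fintype.card ι) := Fintype.equivFin ι
  set g : Fin (Fintype.card ι) → ℝ := f ∘ e.symm with hg
  set σ : Equiv.Perm (Fin (Fintype.card ι)) := Tuple.sort g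
  have hmono : Monotone (g ∘ σ) := Tuple.monotone_sort g
  refine ⟨fun a => (σ.symm (e a) : ℕ), fun a b h => ?_, fun a b h => ?_⟩
  · exact e.injective (σ.symm.injective (Fin.val_injective h))
  · have h' : σ.symm (e a) ≤ σ.symm (e b) := by exact_mod_cast h
    have := hmono h'
    simpa [hg] using this

/-! ## Oblique tensors: `ρ^θ(t) = H_θ(supp t)` -/

section Oblique

variable {K : Type*} [Field K] {ι κ μ : Type*} [Fintype ι] [Fintype κ] [Fintype μ]
variable [DecidableEq ι] [DecidableEq κ] [DecidableEq μ]

/-- **Strassen; CVZ Thm. 2.19 (`≥` half), tensors oblique in the standard bases.** If the support of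
`t` is an antichain for the product of three total orders (given by injective weights `wᵢ`), then for
every probability distribution `P` supported in `supp t` and every `θ ≥ 0`,
`H_θ(P) ≤ ρ^θ(t) = min_{bases} H_θ(supp_C t)`. [cite: ChristandlVranaZuiddam2023, Thm. 2.19] -/
theorem weightedEntropy_le_logUpperSupportFunctional_of_antichain {W₁ W₂ W₃ : Type*}
    [LinearOrder W₁] [LinearOrder W₂] [LinearOrder W₃] {θ : Fin 3 → ℝ} (hθ : ∀ i, 0 ≤ θ i)
    (t : ι → κ → μ → K) (w₁ : ι → W₁) (w₂ : κ → W₂) (w₃ : μ → W₃) (hw₁ : Function.Injective w₁)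
    (hw₂ : Function.Injective w₂) (hw₃ : Function.Injective w₃)
    (hanti : ∀ x ∈ tensorSupport t, ∀ y ∈ tensorSupport t,
      w₁ x.1 ≤ w₁ y.1 → w₂ x.2.1 ≤ w₂ y.2.1 → w₃ x.2.2 ≤ w₃ y.2.2 → y = x)
    {P : ι × κ × μ → ℝ} (hP : P ∈ stdSimplex ℝ (ι × κ × μ))
    (hsupp : Function.support P ⊆ tensorSupport t) :
    weightedEntropy θ P ≤ logUpperSupportFunctional θ t := by
  classical
  obtain ⟨x₀, hx₀⟩ : (tensorSupport t).Nonempty := by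
    obtain ⟨y, -, hy⟩ := Finset.exists_ne_zero_of_sum_ne_zero (hP.2.trans_ne one_ne_zero)
    exact ⟨y, hsupp (Function.mem_support.2 hy)⟩
  unfold logUpperSupportFunctional
  refine le_ciInf fun g => ?_
  have hA : IsUnit (g.1 : Matrix ι ι K).det := Matrix.isUnits_det_units g.1
  have hB : IsUnit (g.2.1 : Matrix κ κ K).det := Matrix.isUnits_det_units g.2.1
  have hC : IsUnit (g.2.2 : Matrix μ μ K).det := Matrix.isUnits_det_units g.2.2
  set Φ := tensorSupport (actTensor (g.1 : Matrix ι ι K) (g.2.1 : Matrix κ κ K)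
    (g.2.2 : Matrix μ μ K) t) with hΦ
  -- `Φ` is nonempty (permutation lemma with arbitrary ranks)
  have hΦne : Φ.Nonempty := by
    obtain ⟨φ₁, φ₂, φ₃, -, -, -, h⟩ := exists_injective_support_le t w₁ w₂ w₃ hw₁ hw₂ hw₃ hanti
      (Fintype.equivFin ι) (Fintype.equivFin κ) (Fintype.equivFin μ)
      (Fintype.equivFin ι).injective (Fintype.equivFin κ).injective (Fintype.equivFin μ).injective
      _ _ _ hA hB hC
    obtain ⟨y, hy, -⟩ := h x₀ hx₀
    exact ⟨y, hy⟩
  -- a maximiser `Q` of `H_θ` on `P(Φ)` and ranks along which its marginals increase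
  obtain ⟨Q, ⟨hQs, hQsupp⟩, hmax⟩ := exists_isMaxOn_weightedEntropy θ hΦne
  rw [maxWeightedEntropy_eq_of_isMaxOn ⟨hQs, hQsupp⟩ hmax]
  obtain ⟨r₁, hr₁, hr₁m⟩ := exists_rank_monotone (marginalDist₁ Q)
  obtain ⟨r₂, hr₂, hr₂m⟩ := exists_rank_monotone (marginalDist₂ Q)
  obtain ⟨r₃, hr₃, hr₃m⟩ := exists_rank_monotone (marginalDist₃ Q)
  obtain ⟨φ₁, φ₂, φ₃, hφ₁, hφ₂, hφ₃, hdom⟩ := exists_injective_support_le t w₁ w₂ w₃ hw₁ hw₂ hw₃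
    hanti r₁ r₂ r₃ hr₁ hr₂ hr₃ _ _ _ hA hB hC
  have hkkt := fun y (hy : y ∈ Φ) => IsMaxOn.marginal_pos_and_score_le hθ hQs hQsupp hmax hy
  have hm₁ := marginalDist₁_mem_stdSimplex hQs
  have hm₂ := marginalDist₂_mem_stdSimplex hQs
  have hm₃ := marginalDist₃_mem_stdSimplex hQs
  -- for `y ∈ supp t`: the dominating point `z ∈ Φ`
  have hdom' : ∀ y ∈ tensorSupport t, ∃ z ∈ Φ,
      ((0 < θ 0 → 0 < marginalDist₁ Q z.1 ∧ marginalDist₁ Q z.1 ≤ marginalDist₁ Q (φ₁ y.1)) ∧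
       (0 < θ 1 → 0 < marginalDist₂ Q z.2.1 ∧ marginalDist₂ Q z.2.1 ≤ marginalDist₂ Q (φ₂ y.2.1)) ∧
       (0 < θ 2 → 0 < marginalDist₃ Q z.2.2 ∧ marginalDist₃ Q z.2.2 ≤ marginalDist₃ Q (φ₃ y.2.2))) := by
    intro y hy
    obtain ⟨z, hz, hz₁, hz₂, hz₃⟩ := hdom y hy
    obtain ⟨⟨hp₁, hp₂, hp₃⟩, -⟩ := hkkt z hz
    exact ⟨z, hz, fun h => ⟨hp₁ h, hr₁m _ _ hz₁⟩, fun h => ⟨hp₂ h, hr₂m _ _ hz₂⟩,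
      fun h => ⟨hp₃ h, hr₃m _ _ hz₃⟩⟩
  -- Gibbs' inequality with the dual variables `Qᵢ ∘ φᵢ`
  have hG := weightedEntropy_le_sum_mul_score hθ hP (Q₁ := fun a => marginalDist₁ Q (φ₁ a))
    (Q₂ := fun b => marginalDist₂ Q (φ₂ b)) (Q₃ := fun c => marginalDist₃ Q (φ₃ c))
    (fun a => hm₁.1 _)
    (by rw [(Finite.injective_iff_bijective.1 hφ₁).sum_comp (marginalDist₁ Q), hm₁.2])
    (fun b => hm₂.1 _)
    (by rw [(Finite.injective_iff_bijective.1 hφ₂).sum_comp (marginalDist₂ Q), hm₂.2])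
    (fun c => hm₃.1 _)
    (by rw [(Finite.injective_iff_bijective.1 hφ₃).sum_comp (marginalDist₃ Q), hm₃.2])
    (by
      intro y hy
      obtain ⟨z, -, h₁, h₂, h₃⟩ := hdom' y (hsupp (Function.mem_support.2 hy))
      exact ⟨fun h => (h₁ h).1.trans_le (h₁ h).2, fun h => (h₂ h).1.trans_le (h₂ h).2,
        fun h => (h₃ h).1.trans_le (h₃ h).2⟩)
  refine hG.trans ?_
  -- each score is at most `H_θ(Q)`
  have cmp : ∀ θi m₁ m₂ : ℝ, 0 ≤ θi → (0 < θi → 0 < m₂ ∧ m₂ ≤ m₁) →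
      θi * (-Real.log m₁ / Real.log 2) ≤ θi * (-Real.log m₂ / Real.log 2) := by
    intro θi m₁ m₂ h0 h
    rcases h0.eq_or_lt with h0 | h0
    · rw [← h0]; simp
    · obtain ⟨hm₂, hle⟩ := h h0
      refine mul_le_mul_of_nonneg_left ?_ h0.le
      exact div_le_div_of_nonneg_right (neg_le_neg (Real.log_le_log hm₂ hle))
        (Real.log_nonneg one_le_two)
  calc ∑ y, P y * (θ 0 * (-Real.log (marginalDist₁ Q (φ₁ y.1)) / Real.log 2) +
          θ 1 * (-Real.log (marginalDist₂ Q (φ₂ y.2.1)) / Real.log 2) +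
          θ 2 * (-Real.log (marginalDist₃ Q (φ₃ y.2.2)) / Real.log 2))
      ≤ ∑ y, P y * weightedEntropy θ Q := by
        refine Finset.sum_le_sum fun y _ => ?_
        by_cases hPy : P y = 0
        · rw [hPy, zero_mul, zero_mul]
        refine mul_le_mul_of_nonneg_left ?_ (hP.1 y)
        obtain ⟨z, hz, h₁, h₂, h₃⟩ := hdom' y (hsupp (Function.mem_support.2 hPy))
        refine le_trans ?_ (hkkt z hz).2
        exact add_le_add (add_le_add (cmp _ _ _ (hθ 0) h₁) (cmp _ _ _ (hθ 1) h₂))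
          (cmp _ _ _ (hθ 2) h₃)
    _ = weightedEntropy θ Q := by rw [← Finset.sum_mul, hP.2, one_mul]

/-- **Strassen; CVZ Thm. 2.19 for tensors oblique in the standard bases:** if `supp t` is an
antichain for a product of total orders, then `ρ^θ(t) = H_θ(supp t)` for every `θ ≥ 0` — the
minimum over bases in Def. 2.3 is attained at the standard bases.
[cite: ChristandlVranaZuiddam2023, Thm. 2.19] -/
theorem logUpperSupportFunctional_eq_maxWeightedEntropy_of_antichain {W₁ W₂ W₃ : Type*}
    [LinearOrder W₁] [LinearOrder W₂] [LinearOrder W₃] {θ : Fin 3 → ℝ} (hθ : ∀ i, 0 ≤ θ i)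
    (t : ι → κ → μ → K) (w₁ : ι → W₁) (w₂ : κ → W₂) (w₃ : μ → W₃) (hw₁ : Function.Injective w₁)
    (hw₂ : Function.Injective w₂) (hw₃ : Function.Injective w₃)
    (hanti : ∀ x ∈ tensorSupport t, ∀ y ∈ tensorSupport t,
      w₁ x.1 ≤ w₁ y.1 → w₂ x.2.1 ≤ w₂ y.2.1 → w₃ x.2.2 ≤ w₃ y.2.2 → y = x) :
    logUpperSupportFunctional θ t = maxWeightedEntropy θ (tensorSupport t) := by
  refine le_antisymm (logUpperSupportFunctional_le hθ t) ?_
  rcases (tensorSupport t).eq_empty_or_nonempty with h | h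
  · rw [h, maxWeightedEntropy_empty]
    exact logUpperSupportFunctional_nonneg hθ t
  · obtain ⟨Q, ⟨hQs, hQsupp⟩, hmax⟩ := exists_isMaxOn_weightedEntropy θ h
    rw [maxWeightedEntropy_eq_of_isMaxOn ⟨hQs, hQsupp⟩ hmax]
    exact weightedEntropy_le_logUpperSupportFunctional_of_antichain hθ t w₁ w₂ w₃ hw₁ hw₂ hw₃ hanti
      hQs hQsupp

end Oblique

/-! ## Matrix multiplication tensors -/

section MatMul

variable (K : Type*) [Field K]

/-- The support of `⟨a,b,c⟩` in the standard bases: `{((i,k),(i,j),(j,k))}`.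
[cite: Blaser2013, §5 (the tensor ⟨k,m,n⟩)] -/
theorem mem_tensorSupport_matMulTensor {a b c : ℕ}
    (x : (Fin a × Fin c) × (Fin a × Fin b) × (Fin b × Fin c)) :
    x ∈ tensorSupport (matMulTensor K a b c) ↔
      x.1.1 = x.2.1.1 ∧ x.2.1.2 = x.2.2.1 ∧ x.1.2 = x.2.2.2 := by
  simp [tensorSupport, matMulTensor]

/-- **The support of `⟨a,b,c⟩` is an antichain** for the lexicographic orders `(k, i)` on
`Fin a × Fin c`, `(j, -i)` on `Fin a × Fin b` and `(-j, -k)` on `Fin b × Fin c` (it is tight,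
BCS Rem. 15.35(3), and tight sets are antichains for the orders induced by the weights, CVZ Rem. 4.2).
[cite: BurgisserClausenShokrollahi1997, Rem. 15.35(3)] -/
theorem matMulTensor_support_antichain (a b c : ℕ) :
    ∀ x ∈ tensorSupport (matMulTensor K a b c), ∀ y ∈ tensorSupport (matMulTensor K a b c),
      toLex ((x.1.2 : ℕ), (x.1.1 : ℕ)) ≤ toLex ((y.1.2 : ℕ), (y.1.1 : ℕ)) →
      toLex ((x.2.1.2 : ℕ), (x.2.1.1.rev : ℕ)) ≤ toLex ((y.2.1.2 : ℕ), (y.2.1.1.rev : ℕ)) →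
      toLex ((x.2.2.1.rev : ℕ), (x.2.2.2.rev : ℕ)) ≤ toLex ((y.2.2.1.rev : ℕ), (y.2.2.2.rev : ℕ)) →
        y = x := by
  rintro ⟨⟨i, k⟩, ⟨i₁, j⟩, ⟨j₁, k₁⟩⟩ hx ⟨⟨i', k'⟩, ⟨i₁', j'⟩, ⟨j₁', k₁'⟩⟩ hy h₁ h₂ h₃
  simp only [mem_tensorSupport_matMulTensor] at hx hy
  obtain ⟨rfl, rfl, rfl⟩ := hx
  obtain ⟨rfl, rfl, rfl⟩ := hy
  simp only [Prod.Lex.le_iff, ofLex_toLex, Fin.val_rev] at h₁ h₂ h₃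
  have hi := i.isLt
  have hi' := i'.isLt
  have hj := j.isLt
  have hj' := j'.isLt
  have hk := k.isLt
  have hk' := k'.isLt
  have ej : (j : ℕ) = j' := by omega
  have ek : (k : ℕ) = k' := by omega
  have ei : (i : ℕ) = i' := by omega
  simp only [Prod.mk.injEq]
  exact ⟨⟨(Fin.ext ei).symm, (Fin.ext ek).symm⟩, ⟨(Fin.ext ei).symm, (Fin.ext ej).symm⟩,
    (Fin.ext ej).symm, (Fin.ext ek).symm⟩

/-- The three lexicographic weights are injective (first factor). [folklore] -/
theorem injective_matMulWeight₁ (a c : ℕ) :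
    Function.Injective fun x : Fin a × Fin c => toLex ((x.2 : ℕ), (x.1 : ℕ)) := by
  rintro ⟨i, k⟩ ⟨i', k'⟩ h
  have h' := toLex.injective h
  simp only [Prod.mk.injEq] at h'
  exact Prod.ext (Fin.ext h'.2) (Fin.ext h'.1)

/-- The three lexicographic weights are injective (second factor). [folklore] -/
theorem injective_matMulWeight₂ (a b : ℕ) :
    Function.Injective fun x : Fin a × Fin b => toLex ((x.2 : ℕ), (x.1.rev : ℕ)) := by
  rintro ⟨i, j⟩ ⟨i', j'⟩ h
  have h' := toLex.injective h
  simp only [Prod.mk.injEq] at h'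
  exact Prod.ext (Fin.rev_injective (Fin.ext h'.2)) (Fin.ext h'.1)

/-- The three lexicographic weights are injective (third factor). [folklore] -/
theorem injective_matMulWeight₃ (b c : ℕ) :
    Function.Injective fun x : Fin b × Fin c => toLex ((x.1.rev : ℕ), (x.2.rev : ℕ)) := by
  rintro ⟨j, k⟩ ⟨j', k'⟩ h
  have h' := toLex.injective h
  simp only [Prod.mk.injEq] at h'
  exact Prod.ext (Fin.rev_injective (Fin.ext h'.1)) (Fin.rev_injective (Fin.ext h'.2))

variable {K}

/-- The uniform distribution on `supp ⟨a,b,c⟩`: first marginal is uniform, `= 1/(ac)`. [folklore] -/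
theorem marginalDist₁_uniform_matMul {a b c : ℕ} (ha : 1 ≤ a) (hb : 1 ≤ b) (hc : 1 ≤ c)
    (x : Fin a × Fin c) :
    marginalDist₁ (fun y : (Fin a × Fin c) × (Fin a × Fin b) × (Fin b × Fin c) =>
      if y.1.1 = y.2.1.1 ∧ y.2.1.2 = y.2.2.1 ∧ y.1.2 = y.2.2.2 then ((a * b * c : ℕ) : ℝ)⁻¹ else 0) x =
      ((a * c : ℕ) : ℝ)⁻¹ := by
  obtain ⟨i, k⟩ := x
  have ha0 : (a : ℝ) ≠ 0 := by exact_mod_cast (by omega : a ≠ 0)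
  have hb0 : (b : ℝ) ≠ 0 := by exact_mod_cast (by omega : b ≠ 0)
  have hc0 : (c : ℝ) ≠ 0 := by exact_mod_cast (by omega : c ≠ 0)
  simp only [marginalDist₁]
  have inner : ∀ β : Fin a × Fin b, (∑ γ : Fin b × Fin c,
      (if i = β.1 ∧ β.2 = γ.1 ∧ k = γ.2 then ((a * b * c : ℕ) : ℝ)⁻¹ else 0)) =
      if i = β.1 then ((a * b * c : ℕ) : ℝ)⁻¹ else 0 := by
    intro β
    rw [Finset.sum_eq_single (β.2, k)]
    · by_cases h : i = β.1 <;> simp [h]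
    · rintro ⟨j', k'⟩ - hne
      rw [if_neg]
      rintro ⟨-, h2, h3⟩
      exact hne (Prod.ext h2.symm h3.symm)
    · simp
  simp_rw [inner]
  rw [Fintype.sum_prod_type]
  have hconst : ∀ x : Fin a, (∑ _y : Fin b, (if i = x then ((a * b * c : ℕ) : ℝ)⁻¹ else 0)) =
      (b : ℝ) * (if i = x then ((a * b * c : ℕ) : ℝ)⁻¹ else 0) := by
    intro x
    rw [Finset.sum_const, Finset.card_univ, Fintype.card_fin, nsmul_eq_mul]
  simp only [hconst]
  rw [← Finset.mul_sum, Finset.sum_ite_eq Finset.univ i, if_pos (Finset.mem_univ _)]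
  push_cast
  field_simp

/-- The uniform distribution on `supp ⟨a,b,c⟩`: second marginal is uniform, `= 1/(ab)`. [folklore] -/
theorem marginalDist₂_uniform_matMul {a b c : ℕ} (ha : 1 ≤ a) (hb : 1 ≤ b) (hc : 1 ≤ c)
    (x : Fin a × Fin b) :
    marginalDist₂ (fun y : (Fin a × Fin c) × (Fin a × Fin b) × (Fin b × Fin c) =>
      if y.1.1 = y.2.1.1 ∧ y.2.1.2 = y.2.2.1 ∧ y.1.2 = y.2.2.2 then ((a * b * c : ℕ) : ℝ)⁻¹ else 0) x =
      ((a * b : ℕ) : ℝ)⁻¹ := by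
  obtain ⟨i, j⟩ := x
  have ha0 : (a : ℝ) ≠ 0 := by exact_mod_cast (by omega : a ≠ 0)
  have hb0 : (b : ℝ) ≠ 0 := by exact_mod_cast (by omega : b ≠ 0)
  have hc0 : (c : ℝ) ≠ 0 := by exact_mod_cast (by omega : c ≠ 0)
  simp only [marginalDist₂]
  have inner : ∀ α : Fin a × Fin c, (∑ γ : Fin b × Fin c,
      (if α.1 = i ∧ j = γ.1 ∧ α.2 = γ.2 then ((a * b * c : ℕ) : ℝ)⁻¹ else 0)) =
      if α.1 = i then ((a * b * c : ℕ) : ℝ)⁻¹ else 0 := by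
    intro α
    rw [Finset.sum_eq_single (j, α.2)]
    · by_cases h : α.1 = i <;> simp [h]
    · rintro ⟨j', k'⟩ - hne
      rw [if_neg]
      rintro ⟨-, h2, h3⟩
      exact hne (Prod.ext h2.symm h3.symm)
    · simp
  simp_rw [inner]
  rw [Fintype.sum_prod_type]
  have hconst : ∀ x : Fin a, (∑ _y : Fin c, (if x = i then ((a * b * c : ℕ) : ℝ)⁻¹ else 0)) =
      (c : ℝ) * (if x = i then ((a * b * c : ℕ) : ℝ)⁻¹ else 0) := by
    intro x
    rw [Finset.sum_const, Finset.card_univ, Fintype.card_fin, nsmul_eq_mul]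
  simp only [hconst]
  rw [← Finset.mul_sum, Finset.sum_ite_eq' Finset.univ i, if_pos (Finset.mem_univ _)]
  push_cast
  field_simp

/-- The uniform distribution on `supp ⟨a,b,c⟩`: third marginal is uniform, `= 1/(bc)`. [folklore] -/
theorem marginalDist₃_uniform_matMul {a b c : ℕ} (ha : 1 ≤ a) (hb : 1 ≤ b) (hc : 1 ≤ c)
    (x : Fin b × Fin c) :
    marginalDist₃ (fun y : (Fin a × Fin c) × (Fin a × Fin b) × (Fin b × Fin c) =>
      if y.1.1 = y.2.1.1 ∧ y.2.1.2 = y.2.2.1 ∧ y.1.2 = y.2.2.2 then ((a * b * c : ℕ) : ℝ)⁻¹ else 0) x =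
      ((b * c : ℕ) : ℝ)⁻¹ := by
  obtain ⟨j, k⟩ := x
  have ha0 : (a : ℝ) ≠ 0 := by exact_mod_cast (by omega : a ≠ 0)
  have hb0 : (b : ℝ) ≠ 0 := by exact_mod_cast (by omega : b ≠ 0)
  have hc0 : (c : ℝ) ≠ 0 := by exact_mod_cast (by omega : c ≠ 0)
  simp only [marginalDist₃]
  have inner : ∀ α : Fin a × Fin c, (∑ β : Fin a × Fin b,
      (if α.1 = β.1 ∧ β.2 = j ∧ α.2 = k then ((a * b * c : ℕ) : ℝ)⁻¹ else 0)) =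
      if α.2 = k then ((a * b * c : ℕ) : ℝ)⁻¹ else 0 := by
    intro α
    rw [Finset.sum_eq_single (α.1, j)]
    · by_cases h : α.2 = k <;> simp [h]
    · rintro ⟨i', j'⟩ - hne
      rw [if_neg]
      rintro ⟨h1, h2, -⟩
      exact hne (Prod.ext h1.symm h2)
    · simp
  simp_rw [inner]
  rw [Fintype.sum_prod_type]
  have hinner : (∑ y : Fin c, (if y = k then ((a * b * c : ℕ) : ℝ)⁻¹ else 0)) =
      ((a * b * c : ℕ) : ℝ)⁻¹ := by
    rw [Finset.sum_ite_eq' Finset.univ k, if_pos (Finset.mem_univ _)]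
  simp only [hinner]
  rw [Finset.sum_const, Finset.card_univ, Fintype.card_fin, nsmul_eq_mul]
  push_cast
  field_simp

/-- The Shannon entropy of the uniform distribution on a finite type of cardinality `n` is `log₂ n`.
[folklore] -/
theorem shannonEntropy_const_inv_card {α : Type*} [Fintype α] {n : ℕ} (hn : Fintype.card α = n) :
    shannonEntropy (fun _ : α => ((n : ℕ) : ℝ)⁻¹) = Real.log n / Real.log 2 := by
  rw [shannonEntropy_def, Finset.sum_const, Finset.card_univ, hn, nsmul_eq_mul]
  congr 1
  rcases Nat.eq_zero_or_pos n with rfl | hpos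
  · simp
  · have hn0 : (n : ℝ) ≠ 0 := by exact_mod_cast hpos.ne'
    simp only [Real.negMulLog, Real.log_inv]
    field_simp

/-- The uniform distribution on `supp ⟨a,b,c⟩` is a probability distribution supported in the
support, with `H_θ = θ 0 log₂(ac) + θ 1 log₂(ab) + θ 2 log₂(bc)`. [folklore] -/
theorem uniform_matMul_spec {a b c : ℕ} (ha : 1 ≤ a) (hb : 1 ≤ b) (hc : 1 ≤ c) (θ : Fin 3 → ℝ) :
    let P₀ : (Fin a × Fin c) × (Fin a × Fin b) × (Fin b × Fin c) → ℝ := fun y =>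
      if y.1.1 = y.2.1.1 ∧ y.2.1.2 = y.2.2.1 ∧ y.1.2 = y.2.2.2 then ((a * b * c : ℕ) : ℝ)⁻¹ else 0
    P₀ ∈ stdSimplex ℝ ((Fin a × Fin c) × (Fin a × Fin b) × (Fin b × Fin c)) ∧
      Function.support P₀ ⊆ tensorSupport (matMulTensor K a b c) ∧
      weightedEntropy θ P₀ = θ 0 * (Real.log (a * c) / Real.log 2) +
        θ 1 * (Real.log (a * b) / Real.log 2) + θ 2 * (Real.log (b * c) / Real.log 2) := by
  intro P₀
  have hm₁ : marginalDist₁ P₀ = fun _ => ((a * c : ℕ) : ℝ)⁻¹ :=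
    funext fun x => marginalDist₁_uniform_matMul ha hb hc x
  have hm₂ : marginalDist₂ P₀ = fun _ => ((a * b : ℕ) : ℝ)⁻¹ :=
    funext fun x => marginalDist₂_uniform_matMul ha hb hc x
  have hm₃ : marginalDist₃ P₀ = fun _ => ((b * c : ℕ) : ℝ)⁻¹ :=
    funext fun x => marginalDist₃_uniform_matMul ha hb hc x
  refine ⟨⟨fun y => ?_, ?_⟩, fun y hy => ?_, ?_⟩
  · simp only [P₀]
    split_ifs
    · positivity
    · exact le_rfl
  · -- total mass = sum of the first marginal
    have e : ∑ y, P₀ y = ∑ x, marginalDist₁ P₀ x := by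
      simp only [marginalDist₁, Fintype.sum_prod_type]
    rw [e, hm₁, Finset.sum_const, Finset.card_univ, Fintype.card_prod, Fintype.card_fin,
      Fintype.card_fin, nsmul_eq_mul]
    have : ((a * c : ℕ) : ℝ) ≠ 0 := by
      exact_mod_cast Nat.mul_ne_zero (by omega) (by omega)
    field_simp
  · rw [Function.mem_support] at hy
    rw [mem_tensorSupport_matMulTensor]
    by_contra h
    exact hy (if_neg h)
  · simp only [weightedEntropy, hm₁, hm₂, hm₃]
    rw [shannonEntropy_const_inv_card (by simp), shannonEntropy_const_inv_card (by simp),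
      shannonEntropy_const_inv_card (by simp)]
    push_cast
    ring

/-- **Strassen; CLLZ Lemma 4.1, logarithmic form:** for `a, b, c ≥ 1` and `θ ≥ 0`,
`ρ^θ(⟨a,b,c⟩) = θ 0 · log₂(ac) + θ 1 · log₂(ab) + θ 2 · log₂(bc)` (tree's index convention: the three
index types of `matMulTensor K a b c` have sizes `ac, ab, bc`).
[cite: ChristandlLeGallLysikovZuiddam2025, Lemma 4.1] -/
theorem logUpperSupportFunctional_matMulTensor {θ : Fin 3 → ℝ} (hθ : ∀ i, 0 ≤ θ i) {a b c : ℕ}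
    (ha : 1 ≤ a) (hb : 1 ≤ b) (hc : 1 ≤ c) :
    logUpperSupportFunctional θ (matMulTensor K a b c) = θ 0 * (Real.log (a * c) / Real.log 2) +
      θ 1 * (Real.log (a * b) / Real.log 2) + θ 2 * (Real.log (b * c) / Real.log 2) := by
  refine le_antisymm ?_ ?_
  · refine (logUpperSupportFunctional_le hθ _).trans ((maxWeightedEntropy_le_card hθ _).trans ?_)
    simp [Fintype.card_prod, Fintype.card_fin]
  · obtain ⟨hP₀, hsupp, hval⟩ := uniform_matMul_spec (K := K) ha hb hc θ
    rw [← hval]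
    exact weightedEntropy_le_logUpperSupportFunctional_of_antichain hθ (matMulTensor K a b c)
      _ _ _ (injective_matMulWeight₁ a c) (injective_matMulWeight₂ a b) (injective_matMulWeight₃ b c)
      (matMulTensor_support_antichain K a b c) hP₀ hsupp

/-- **Strassen ([Str91]); CLLZ Lemma 4.1: the upper support functional of a matrix multiplication
tensor** is the `θ`-weighted geometric mean of its three flattening dimensions: for every field `K`,
`θ ∈ P([3])` and `a, b, c ≥ 1`, `ζ^θ(⟨a,b,c⟩) = a^{θ 0+θ 1} b^{θ 1+θ 2} c^{θ 0+θ 2}` (tree's convention;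
printed as `a^{θ₁+θ₃} b^{θ₁+θ₂} c^{θ₂+θ₃}` for CLLZ's labelling `ab, bc, ca` of the factors).
[cite: ChristandlLeGallLysikovZuiddam2025, Lemma 4.1] -/
theorem upperSupportFunctional_matMulTensor {θ : Fin 3 → ℝ} (hθ : θ ∈ stdSimplex ℝ (Fin 3))
    {a b c : ℕ} (ha : 1 ≤ a) (hb : 1 ≤ b) (hc : 1 ≤ c) :
    upperSupportFunctional θ (matMulTensor K a b c) =
      (a : ℝ) ^ (θ 0 + θ 1) * (b : ℝ) ^ (θ 1 + θ 2) * (c : ℝ) ^ (θ 0 + θ 2) := by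
  have ht : matMulTensor K a b c ≠ 0 := by
    intro h
    have := congrFun (congrFun (congrFun h (⟨0, ha⟩, ⟨0, hc⟩)) (⟨0, ha⟩, ⟨0, hb⟩)) (⟨0, hb⟩, ⟨0, hc⟩)
    simp [matMulTensor] at this
  unfold upperSupportFunctional
  rw [if_neg ht, logUpperSupportFunctional_matMulTensor hθ.1 ha hb hc]
  have ha' : (0 : ℝ) < a := by exact_mod_cast ha
  have hb' : (0 : ℝ) < b := by exact_mod_cast hb
  have hc' : (0 : ℝ) < c := by exact_mod_cast hc
  have h2 : (0 : ℝ) < 2 := two_pos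
  have key : ∀ (x : ℝ) (s : ℝ), 0 < x → (2 : ℝ) ^ (s * (Real.log x / Real.log 2)) = x ^ s := by
    intro x s hx
    rw [Real.log_div_log, mul_comm, Real.rpow_mul h2.le, Real.rpow_logb h2 (by norm_num) hx]
  rw [Real.rpow_add h2, Real.rpow_add h2, key _ _ (mul_pos ha' hc'), key _ _ (mul_pos ha' hb'),
    key _ _ (mul_pos hb' hc'), Real.mul_rpow ha'.le hc'.le, Real.mul_rpow ha'.le hb'.le,
    Real.mul_rpow hb'.le hc'.le, Real.rpow_add ha', Real.rpow_add hb', Real.rpow_add hc']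
  ring

end MatMul

end Literature.Computability.AlgebraicComplexity

end
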